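import Mathlib
import Literature.Analysis.FluidPDE.VectorCalculus
import Literature.Analysis.FluidPDE.ClassicalSolution
import Literature.Analysis.FluidPDE.SelfSimilar
import HarnessLib

/-!
# The angular Galerkin ladder `NS_L` — SO(3)-isotypic truncation of Navier–Stokes about a point
(DEFINITIONS ONLY)

Cell `ns-blowup`, seat `ns-blowup-plan` (g19; PLANCARD «angular-galerkin-ladder», DIRECTOR-NS
2026-08-26 (f)). LABEL: KERNEL typing — definitions, no named fact, nothing asserted, no inhabitant
claimed. WHAT THIS IS NOT: not Navier–Stokes evidence — it is the vocabulary over which the route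
`Theses/AngularGalerkinLadder.lean` states its cruxes.

## Content

The rotation group acts on vector fields `u : ℝ³ → ℝ³` about the origin by
`(ρ(g)u)(x) = g u(g⁻¹x)`. Its infinitesimal generators are
`(J_a u)(x) = e_a × u(x) − ((e_a × x)·∇)u(x)` (`angGen`), and the Casimir operator
`𝒞 = −Σ_a J_a²` (`casimir`) acts on the isotypic component of total angular degree `j` (the span of
the three vector spherical harmonics `f(r) Y_{jm} x̂`, `g(r) r∇Y_{jm}`, `h(r) x × ∇Y_{jm}` with
radial coefficients) as the scalar `j(j+1)`. A smooth field is therefore ANGULARLY BAND-LIMITED to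
degrees `≤ L` iff `∏_{j ≤ L} (𝒞 − j(j+1)) u = 0` pointwise (`bandDefect`, `IsBandLimited`): no
projection operator, Haar measure or spherical-harmonic basis is needed to STATE the cut. A field
`g` is CO-BAND-LIMITED (`IsCobandLimited`) when it is `L²`-orthogonal to every compactly supported
band-limited test field, i.e. it carries only degrees `> L`.

RUNG `L` OF THE LADDER (`IsRungSolutionOn`): a classical solution `(u, p)` of the Navier–Stokes
system FORCED by a field `d` (tree predicate `IsClassicalNSSolutionOn S ν d u p`, which includes
`div u = 0` and joint smoothness) whose velocity slices are band-limited to degree `≤ L` and whose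
force slices are co-band-limited. Since the isotypic projection `Π_L` commutes with the Laplacian,
the Leray projector, `div`, rotations and dilations about the centre, this is exactly the Galerkin
sub-dynamics `∂ₜu = νΔu − Π_L P(u·∇u)` with `d = (1 − Π_L)P(u·∇u)` up to the pressure gauge (the
structure lemma is a route support target, not asserted here). Rung solutions keep the exact
Navier–Stokes scaling and rotation symmetries about the centre and the energy identity.

PROFILES (`IsRungProfile`, `RungIsSingular`, `IsWindowProfile`): ancient rung solutions on
`(−∞, 0) × ℝ³` at `ν = 1` that are rotated discretely self-similar (tree `IsRotatedDSS`, Chae–Wolf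
Def. 1.1) with Type-I decay (tree `HasTypeIDecay`, KNSS (1.6)); the scale-invariant size of the
Galerkin defect is `HasDefectBound ε d : ‖d(t,x)‖ ≤ ε (‖x‖ + √−t)⁻³`.

References: restricted Euler / velocity-gradient dynamics (rung two of the ladder)
[cite: Vieillefosse1984] [cite: Cantwell1992]; low-order harmonic truncations and their failure under
refinement [cite: BullardGellman1954]; rotated DSS [cite: ChaeWolf2017, Def. 1.1]; Type-I decay
[cite: KNSS2009, (1.6)]; averaged/modified bilinear Navier–Stokes operators [cite: Tao2016AveragedNS, Thm. 1.5].
-/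

noncomputable section

namespace Summit.NavierStokesRegularity.FluidComputer

open Set MeasureTheory Filter Topology Function
open scoped ContDiff RealInnerProductSpace
open Literature.Analysis.FluidPDE

namespace AngularLadder

/-! ## §1 The rotation generators and the Casimir cut -/

/-- The `a`-th coordinate vector `e_a` of `ℝ³`. [folklore] -/
def axis (a : Fin 3) : EuclideanSpace ℝ (Fin 3) := EuclideanSpace.single a (1 : ℝ)

/-- **Infinitesimal rotation of a vector field about the axis `e_a` through the origin**:
`(J_a u)(x) = e_a × u(x) − ((e_a × x)·∇)u(x)`, the derivative at `θ = 0` of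
`θ ↦ R_θ u(R_θ⁻¹ x)`, `R_θ = exp(θ [e_a]_×)`. Junk value through `fderiv` where `u` is not
differentiable. [folklore] -/
def angGen (a : Fin 3) (u : EuclideanSpace ℝ (Fin 3) → EuclideanSpace ℝ (Fin 3))
    (x : EuclideanSpace ℝ (Fin 3)) : EuclideanSpace ℝ (Fin 3) :=
  cross (axis a) (u x) - fderiv ℝ u x (cross (axis a) x)

/-- **The Casimir operator `𝒞 = −(J₀² + J₁² + J₂²)` of the rotation action on vector fields**; on the
isotypic component of total angular degree `j` (vector spherical harmonics of degree `j` with radial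
coefficients) it is multiplication by `j(j+1)`. [folklore] -/
def casimir (u : EuclideanSpace ℝ (Fin 3) → EuclideanSpace ℝ (Fin 3))
    (x : EuclideanSpace ℝ (Fin 3)) : EuclideanSpace ℝ (Fin 3) :=
  -∑ a : Fin 3, angGen a (angGen a u) x

/-- **The band defect `∏_{j=0}^{L} (𝒞 − j(j+1)) u`**, by recursion on `L`:
`bandDefect 0 u = 𝒞u` and `bandDefect (L+1) u = (𝒞 − (L+1)(L+2)) (bandDefect L u)`. It annihilates
exactly the isotypic components of degree `≤ L` of a smooth field. [folklore] -/
def bandDefect : ℕ → (EuclideanSpace ℝ (Fin 3) → EuclideanSpace ℝ (Fin 3)) →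
    EuclideanSpace ℝ (Fin 3) → EuclideanSpace ℝ (Fin 3)
  | 0, u => casimir u
  | L + 1, u => fun x => casimir (bandDefect L u) x - (((L : ℝ) + 1) * ((L : ℝ) + 2)) • bandDefect L u x

/-- **Angularly band-limited fields of degree `≤ L` about the origin**: `u` is smooth and
`∏_{j ≤ L} (𝒞 − j(j+1)) u = 0` pointwise — equivalently, on every sphere `‖x‖ = r` the field is a
finite combination of vector spherical harmonics of degree `≤ L` with smooth radial coefficients
(the range of the isotypic projection `Π_L`). [folklore] -/
def IsBandLimited (L : ℕ) (u : EuclideanSpace ℝ (Fin 3) → EuclideanSpace ℝ (Fin 3)) : Prop :=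
  ContDiff ℝ ∞ u ∧ ∀ x, bandDefect L u x = 0

/-- **Co-band-limited fields** (only angular degrees `> L`): `g` is `L²`-orthogonal to every
compactly supported band-limited field of degree `≤ L` (the kernel of `Π_L`, stated by duality so
that no projection operator is needed). [folklore] -/
def IsCobandLimited (L : ℕ) (g : EuclideanSpace ℝ (Fin 3) → EuclideanSpace ℝ (Fin 3)) : Prop :=
  ∀ ψ : EuclideanSpace ℝ (Fin 3) → EuclideanSpace ℝ (Fin 3),
    IsBandLimited L ψ → HasCompactSupport ψ → ∫ x, ⟪g x, ψ x⟫ = 0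

/-! ## §2 Rung solutions -/

/-- **Rung `L` of the angular Galerkin ladder on the time set `S`** (`NS_L` about the origin,
viscosity `ν`): `(u, p)` is a classical solution of Navier–Stokes FORCED by `d`
(`∂ₜu + (u·∇)u = νΔu − ∇p + d`, `div u = 0`, jointly smooth), every velocity slice is band-limited
to degree `≤ L` and every force slice is co-band-limited — the force `d` is the Galerkin defect
`(1 − Π_L)P(u·∇u)` up to the pressure gauge, so this is the Galerkin sub-dynamics
`∂ₜu = νΔu − Π_L P(u·∇u)` written without a projection operator. [cite: BullardGellman1954] -/
def IsRungSolutionOn (S : Set ℝ) (ν : ℝ) (L : ℕ)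
    (u : ℝ → EuclideanSpace ℝ (Fin 3) → EuclideanSpace ℝ (Fin 3))
    (p : ℝ → EuclideanSpace ℝ (Fin 3) → ℝ)
    (d : ℝ → EuclideanSpace ℝ (Fin 3) → EuclideanSpace ℝ (Fin 3)) : Prop :=
  IsClassicalNSSolutionOn S ν d u p ∧ (∀ t ∈ S, IsBandLimited L (u t)) ∧
    ∀ t ∈ S, IsCobandLimited L (d t)

/-- **Scale-invariant smallness of a defect force on `(−∞, 0) × ℝ³`**:
`‖d(t, x)‖ ≤ ε / (‖x‖ + √(−t))³` — the weight of `(u·∇)u` for a Type-I field. [cite: KNSS2009, (1.6)] -/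
def HasDefectBound (ε : ℝ) (d : ℝ → EuclideanSpace ℝ (Fin 3) → EuclideanSpace ℝ (Fin 3)) : Prop :=
  ∀ t < 0, ∀ x, ‖d t x‖ ≤ ε / (‖x‖ + Real.sqrt (-t)) ^ 3

/-! ## §3 Type-I rotated-DSS ancient rung profiles -/

/-- **A Type-I rotated-DSS ancient profile on rung `L`** (`ν = 1`, centre = origin): an ancient rung
solution `(u, p, d)` on `(−∞, 0) × ℝ³` with DSS factor `c > 1` and rotation `R`
(`c Rᵀu(c²t, cRx) = u(t, x)`, Chae–Wolf Def. 1.1) and the Type-I bound `‖u(t,x)‖ ≤ C₀/(‖x‖ + √−t)`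
(KNSS (1.6)). The rung analogue of the object negating Tsai's Type-I DSS Liouville conjecture.
[cite: ChaeWolf2017, Def. 1.1] [cite: KNSS2009, (1.6)] -/
def IsRungProfile (L : ℕ) (C₀ c : ℝ)
    (R : EuclideanSpace ℝ (Fin 3) ≃ₗᵢ[ℝ] EuclideanSpace ℝ (Fin 3))
    (u : ℝ → EuclideanSpace ℝ (Fin 3) → EuclideanSpace ℝ (Fin 3))
    (p : ℝ → EuclideanSpace ℝ (Fin 3) → ℝ)
    (d : ℝ → EuclideanSpace ℝ (Fin 3) → EuclideanSpace ℝ (Fin 3)) : Prop :=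
  IsRungSolutionOn (Iio 0) 1 L u p d ∧ 1 < c ∧ IsRotatedDSS c R u ∧ HasTypeIDecay C₀ u

/-- **Rung `L` is singular**: it carries a NONTRIVIAL Type-I rotated-DSS ancient profile.
[cite: ChaeWolf2017, Def. 1.1] -/
def RungIsSingular (L : ℕ) : Prop :=
  ∃ (C₀ c : ℝ) (R : EuclideanSpace ℝ (Fin 3) ≃ₗᵢ[ℝ] EuclideanSpace ℝ (Fin 3))
    (u : ℝ → EuclideanSpace ℝ (Fin 3) → EuclideanSpace ℝ (Fin 3))
    (p : ℝ → EuclideanSpace ℝ (Fin 3) → ℝ)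
    (d : ℝ → EuclideanSpace ℝ (Fin 3) → EuclideanSpace ℝ (Fin 3)),
    IsRungProfile L C₀ c R u p d ∧ ∃ t < 0, ∃ x, u t x ≠ 0

/-- **A rung-`L` profile inside the uniform window `(C₀, [c_min, c_max], δ)` with defect `≤ ε`**:
Type-I constant `C₀`, DSS factor in `[c_min, c_max]`, quantitative nontriviality
`‖u(−1, x)‖ ≥ δ` at some point, and Galerkin defect of scale-invariant size `≤ ε`. The objects the
ladder hands to the compactness step. [cite: KNSS2009, (1.6)] -/
def IsWindowProfile (L : ℕ) (C₀ cmin cmax δ ε : ℝ) (c : ℝ)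
    (R : EuclideanSpace ℝ (Fin 3) ≃ₗᵢ[ℝ] EuclideanSpace ℝ (Fin 3))
    (u : ℝ → EuclideanSpace ℝ (Fin 3) → EuclideanSpace ℝ (Fin 3))
    (p : ℝ → EuclideanSpace ℝ (Fin 3) → ℝ)
    (d : ℝ → EuclideanSpace ℝ (Fin 3) → EuclideanSpace ℝ (Fin 3)) : Prop :=
  IsRungProfile L C₀ c R u p d ∧ cmin ≤ c ∧ c ≤ cmax ∧ (∃ x, δ ≤ ‖u (-1) x‖) ∧ HasDefectBound ε d

/-! ## §4 Bookkeeping (projections; used by the route's deciding theorem) -/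

variable {L : ℕ} {C₀ cmin cmax δ ε c : ℝ}
  {R : EuclideanSpace ℝ (Fin 3) ≃ₗᵢ[ℝ] EuclideanSpace ℝ (Fin 3)}
  {u : ℝ → EuclideanSpace ℝ (Fin 3) → EuclideanSpace ℝ (Fin 3)}
  {p : ℝ → EuclideanSpace ℝ (Fin 3) → ℝ}
  {d : ℝ → EuclideanSpace ℝ (Fin 3) → EuclideanSpace ℝ (Fin 3)}

/-- A rung profile is a classical forced solution on `(−∞, 0)`. [folklore] -/
theorem IsRungProfile.classical (h : IsRungProfile L C₀ c R u p d) :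
    IsClassicalNSSolutionOn (Iio 0) 1 d u p :=
  h.1.1

/-- The DSS factor of a rung profile exceeds `1`. [folklore] -/
theorem IsRungProfile.one_lt (h : IsRungProfile L C₀ c R u p d) : 1 < c :=
  h.2.1

/-- A rung profile is rotated DSS. [folklore] -/
theorem IsRungProfile.isRotatedDSS (h : IsRungProfile L C₀ c R u p d) : IsRotatedDSS c R u :=
  h.2.2.1

/-- A rung profile is Type-I. [folklore] -/
theorem IsRungProfile.hasTypeIDecay (h : IsRungProfile L C₀ c R u p d) : HasTypeIDecay C₀ u :=
  h.2.2.2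

/-- A window profile is a rung profile. [folklore] -/
theorem IsWindowProfile.isRungProfile (h : IsWindowProfile L C₀ cmin cmax δ ε c R u p d) :
    IsRungProfile L C₀ c R u p d :=
  h.1

/-- A window profile with `0 < δ` is nontrivial, so its rung is singular. [folklore] -/
theorem IsWindowProfile.rungIsSingular (h : IsWindowProfile L C₀ cmin cmax δ ε c R u p d)
    (hδ : 0 < δ) : RungIsSingular L := by
  obtain ⟨hP, -, -, ⟨x, hx⟩, -⟩ := h
  refine ⟨C₀, c, R, u, p, d, hP, -1, by norm_num, x, ?_⟩
  intro h0
  rw [h0, norm_zero] at hx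
  exact absurd hx (not_le.mpr hδ)

end AngularLadder

end Summit.NavierStokesRegularity.FluidComputer

end
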